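import Literature.Analysis.ValidatedNumerics.MultiPrecisionInterval
import HarnessLib

/-!
# Lagarias–Rains (2003), §7.3 Question 1 — the kernel certificate

J. C. Lagarias and E. Rains, *On a two-variable zeta function for number fields*,
Ann. Inst. Fourier **53** (2003) 1–68 [LagariasRains2003], ask in §7.3 (Question 1) whether
`Re Z_ℚ(w, s) > 0` on the whole cone `C⁻ = {w = u real, u < Re s < 0}`. The answer is negative at
`(w, s) = (−16, −1/100 + i)` (`LagariasRains2003.Refutation`), where by Theorem 2.1
`Re Z_ℚ = 100/10001 + 159900/2566801 − ∫_1^∞ h(t) dt`,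
`h(t) = (1 − θ(t²)^{−16})(t^{−1.01} + t^{−16.99}) cos(log t) ≥ 0`.

This file is the integer program bounding a right-endpoint Riemann sum of `h` on `[1, 2]` from
below: for the nodes `t = n/64`, `65 ≤ n ≤ 128`, it computes at scale `PREC = 2^64`, with the
interval exponential / logarithm / `π` / `e^{iφ}` of `Literature.Analysis.ValidatedNumerics`,
integers `a, b, c ≥ 0` with `a ≤ PREC·(1 − (1 + 2e^{−πt²})^{−16})`, `b ≤ PREC·(t^{−1.01} + t^{−16.99})`,
`c ≤ PREC·cos(log t)`, and checks `Σ_n ⌊⌊ab/PREC⌋c/PREC⌋ ≥ 64·PREC·(100/10001 + 159900/2566801 + 1/1000)`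
(`certZQ16`, evaluated in the kernel by `certZQ16_true`; standard axioms, no `native_decide`).
Soundness (`h(n/64)·PREC ≥ node value`) is proved in `LagariasRains2003.Refutation`.
-/

open Literature.Analysis.ValidatedNumerics Literature.Analysis.ValidatedNumerics.NumericsMP

namespace Literature.NumberTheory.LFunctions.LagariasRains2003

/-- Binary working scale. [folklore] -/
def PREC : ℕ := 2 ^ 64

/-- Number of Taylor / series terms for `exp`, `log`, `arctan`, `e^{iφ}`. [folklore] -/
def KSER : ℕ := 40

/-- Number of argument halvings in `exp` / `e^{iφ}`. [folklore] -/
def KHALF : ℕ := 5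

/-- Interval for `log (n/64) = log n − log 64`. [folklore] -/
def logRatio (n : ℕ) : Option MI :=
  match MI.logNat PREC KSER n, MI.logNat PREC KSER 64 with
  | some A, some B => some (A.sub B)
  | _, _ => none

/-- For the node `t = n/64`: scaled lower bounds `(a, b, c)`, all `≥ 0`, of
`1 − (1 + 2e^{−π t²})^{−16}`, `t^{−101/100} + t^{−1699/100}` and `cos (log t)`, given an
enclosure `P ∋ π`. [folklore] -/
def nodeParts (P : MI) (n : ℕ) : Option (ℤ × ℤ × ℤ) :=
  match MI.exp PREC KSER KHALF (MI.neg (MI.mul PREC P (MI.ofFrac PREC ((n * n : ℕ) : ℤ) 4096))),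
    logRatio n with
  | some E, some L =>
    let q : ℤ := max E.lo 0
    let P16 : ℤ := (MI.sqrIter PREC 4 (MI.ofScaled ((PREC : ℤ) + 2 * q))).lo
    if 0 < P16 then
      match MI.exp PREC KSER KHALF ((L.mulInt (-101)).divNat 100),
        MI.exp PREC KSER KHALF ((L.mulInt (-1699)).divNat 100),
        MC.expI PREC KSER KHALF P L with
      | some E1, some E2, some C =>
        some (max ((PREC : ℤ) - Numerics.cdiv ((PREC : ℤ) * PREC) P16) 0,
          max (E1.lo + E2.lo) 0, max C.re.lo 0)
      | _, _, _ => none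
    else none
  | _, _ => none

/-- Scaled lower bound `⌊⌊ab/PREC⌋·c/PREC⌋` for `h(n/64)`. [folklore] -/
def nodeLo (P : MI) (n : ℕ) : Option ℤ :=
  match nodeParts P n with
  | some (a, b, c) => some (a * b / (PREC : ℤ) * c / (PREC : ℤ))
  | none => none

/-- Scaled lower bound for `Σ_{i<N} h((65+i)/64)`. [folklore] -/
def sumLo (P : MI) : ℕ → Option ℤ
  | 0 => some 0
  | i + 1 =>
    match sumLo P i, nodeLo P (65 + i) with
    | some a, some b => some (a + b)
    | _, _ => none

/-- **The certificate**: `(1/64) Σ_{n=65}^{128} h(n/64) ≥ 100/10001 + 159900/2566801 + 1/1000`,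
as the integer inequality
`T·10001·2566801·1000 ≥ 64·PREC·(100·2566801·1000 + 159900·10001·1000 + 10001·2566801)`.
[cite: LagariasRains2003, §7.3 Question 1] -/
def certZQ16 : Bool :=
  match MI.pi PREC KSER with
  | some P =>
    match sumLo P 64 with
    | some T => decide (64 * (PREC : ℤ) * (100 * 2566801 * 1000 + 159900 * 10001 * 1000 +
        10001 * 2566801) ≤ T * (10001 * 2566801 * 1000))
    | none => false
  | none => false

set_option maxHeartbeats 4000000 in
/-- The certificate evaluates to `true` in the kernel (GMP-accelerated `Nat`/`Int` reduction;
standard axioms, no `native_decide`). [cite: LagariasRains2003, §7.3 Question 1] -/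
theorem certZQ16_true : certZQ16 = true := by decide +kernel

end Literature.NumberTheory.LFunctions.LagariasRains2003
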